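import Summits.BirchSwinnertonDyer.BirchSwinnertonDyer.Theorems.ManinLocalTwoThreeShimuraIndexMuThree
import Summits.BirchSwinnertonDyer.BirchSwinnertonDyer.Theorems.ManinLocalTwoThreeNoPlusDefectTower
import HarnessLib

/-!
# C3's no-rational-`3`-torsion / no-plus-defect cell (the non-real part of RES₃♭'s habitat) modulo NAMED inputs only:
# off `μ₃`: `hnf` + Kato₃ symbol-closure fact + `KatoCurveExists` + E-an-135₃; on `μ₃`: the same + E-es-67♯

Summit `BirchSwinnertonDyer`, route `ManinLocalTwoThree` (cell bsd-f2-manin), crux C3 `ManinPrimeToThreeAtNine`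
(stmt-BirchSwinnertonDyer-22968), line `kato_shift_three` v18, stub 6 RES₃♭ `NoRationalThreeTorsionCoprimeIsolatedResidual` (the
`W[3]`-reducible, no-rational-`3`-torsion residual).  Prover seat bsd-line-manin23-p1 (C2/C3 LEAD), gen 9.  Pure compositions of tree
theorems, recording the es-road's exact law content on this cell after the lead's reductions (Katz dichotomy p668072, `μ₃`-identification
p669903/…ShimuraIndexMuThree, pointwise lever p668234, an's E-an-136 `threeAdicWitness_of_towerUnitTwist`):

* `not_three_dvd_maninConstant_of_no_shortThreeTorsion_of_not_hasShortMuThree_of_towerUnitTwist` — lattice-optimal `W`, `9 ∣ N`,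
  `CuspidalPlusDefectPrimeTo 3 D`, NO rational `3`-torsion on `E_{W,c}`, `μ₃ ⊄ W` (`¬ HasShortMuThree W D.c`) ⟹ `3 ∤ c`, CONDITIONAL on
  `exists_isNewformOf`, `kato_isIntegral_twistedSymbolSum_three_symbolClosure` (Kato, statement-only), `KatoCurveExists` (S-es-K) and
  E-an-135₃ `TowerUnitTwist 3` — NO E-es-61/66/67.
* `not_three_dvd_maninConstant_of_no_shortThreeTorsion_of_towerUnitTwist_of_sharp` — the same WITHOUT the `μ₃ ⊄ W` clause, at the
  price of es's `μ₃`-law E-es-67♯ `PlusIndexPrimeToThreeOfMuThreeNoRationalThreeTorsion`.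
* `threeAdicUnitWitnessOfNoRationalThreeTorsion_of_towerUnitTwist_of_sharp` — es's E-es-61 from E-an-135₃ ∧ E-es-67♯ (the leaf's
  `threeAdicUnitWitnessOfNoRationalThreeTorsion_of_plusIndex` took E-es-66 ∧ E-es-67).

HONEST FRAMING: by-name compositions; all displayed hypotheses are OPEN (two printed facts statement-only; `KatoCurveExists`,
`TowerUnitTwist 3`, E-es-67♯ cell laws).  The plus-defect part of RES₃♭ (a real cuspidal point of order `3`) is untouched.  C3, Manin's
conjecture and BSD are NOT proved by this file.  No definitions, no sorry.
-/

set_option autoImplicit false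
set_option linter.dupNamespace false

noncomputable section

open scoped Classical MatrixGroups ModularForm

open CongruenceSubgroup Complex WeierstrassCurve Literature.NumberTheory.EllipticCurves
  Literature.NumberTheory.EllipticCurves.ModularForms
open Summit.BirchSwinnertonDyer.Rank1Residual.ManinAdditive.KatoCurve
  Summit.BirchSwinnertonDyer.Rank1Residual.ManinAdditive.CuspidalKummer
  Summit.BirchSwinnertonDyer.Rank1Residual.ManinAdditive.CuspidalKummerThree

namespace Summit.BirchSwinnertonDyer.BirchSwinnertonDyer.Theorems.ManinLocalTwoThree

variable (W : WeierstrassCurve ℚ) [W.IsElliptic] [W.IsGloballyMinimal] {N : ℕ} [NeZero N]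

/-- **Off `μ₃`, the no-`3`-torsion / no-plus-defect cell of C3 closes modulo `hnf` + Kato₃ + `KatoCurveExists` + E-an-135₃:**
lattice-optimal `W`, `9 ∣ N`, no cuspidal plus defect at `3`, no rational `3`-torsion on `E_{W,c}`, `¬ HasShortMuThree W D.c` ⟹ `3 ∤ c`.
(`PlusIndexPrimeTo 3` by `plusIndexPrimeTo_three_of_no_shortThreeTorsion_of_not_hasShortMuThree`; polar witness by E-an-136₃
`threeAdicWitness_of_towerUnitTwist`; pointwise lever `not_three_dvd_maninConstant_of_noPlusDefect_of_witness_stub`.)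
[cite: Kato2004Asterisque, Thm. 12.5 (shape; the named fact is statement-only)] [cite: Katz1980, Thm. 2 (m = ℓ)] -/
theorem not_three_dvd_maninConstant_of_no_shortThreeTorsion_of_not_hasShortMuThree_of_towerUnitTwist
    (hnf : exists_isNewformOf) (hF : kato_isIntegral_twistedSymbolSum_three_symbolClosure) (hK : KatoCurveExists)
    (h135 : TowerUnitTwist 3)
    (D : ModularParametrizationData W N) (hopt : ∀ z ∈ D.L.lattice, ∃ w ∈ periodLattice D.f, z = D.c * w)
    (h9 : 3 ^ 2 ∣ N) (hpd : CuspidalPlusDefectPrimeTo 3 D)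
    (hT : ∀ X₀ Y₀ : ℚ, ¬ IsShortThreeTorsion W D.c X₀ Y₀) (hμ : ¬ HasShortMuThree W D.c) : ¬ (3 : ℤ) ∣ D.c :=
  not_three_dvd_maninConstant_of_noPlusDefect_of_witness_stub W hnf hF hK D hopt h9 hpd
    (threeAdicWitness_of_towerUnitTwist h135 W D hopt h9
      (plusIndexPrimeTo_three_of_no_shortThreeTorsion_of_not_hasShortMuThree W D.isNewformOf
        D.maninConstant_ne_zero_holds hT hμ))

/-- **With es's `μ₃`-law E-es-67♯ the `μ₃ ⊄ W` clause goes:** lattice-optimal `W`, `9 ∣ N`, no cuspidal plus defect at `3`, no rational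
`3`-torsion on `E_{W,c}` ⟹ `3 ∤ c`, modulo `hnf` + Kato₃ + `KatoCurveExists` + E-an-135₃ + E-es-67♯.
[cite: Kato2004Asterisque, Thm. 12.5 (shape; the named fact is statement-only)] [cite: Katz1980, Thm. 2 (m = ℓ)] -/
theorem not_three_dvd_maninConstant_of_no_shortThreeTorsion_of_towerUnitTwist_of_sharp
    (hnf : exists_isNewformOf) (hF : kato_isIntegral_twistedSymbolSum_three_symbolClosure) (hK : KatoCurveExists)
    (h135 : TowerUnitTwist 3) (h67s : PlusIndexPrimeToThreeOfMuThreeNoRationalThreeTorsion)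
    (D : ModularParametrizationData W N) (hopt : ∀ z ∈ D.L.lattice, ∃ w ∈ periodLattice D.f, z = D.c * w)
    (h9 : 3 ^ 2 ∣ N) (hpd : CuspidalPlusDefectPrimeTo 3 D)
    (hT : ∀ X₀ Y₀ : ℚ, ¬ IsShortThreeTorsion W D.c X₀ Y₀) : ¬ (3 : ℤ) ∣ D.c :=
  not_three_dvd_maninConstant_of_noPlusDefect_of_witness_stub W hnf hF hK D hopt h9 hpd
    (threeAdicWitness_of_towerUnitTwist h135 W D hopt h9
      (plusIndexPrimeToThreeOfNoRationalThreeTorsion_of_sharp h67s W D hopt h9 hT))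

omit W [W.IsElliptic] [W.IsGloballyMinimal] [NeZero N] in
/-- **es's E-es-61 `ThreeAdicUnitWitnessOfNoRationalThreeTorsion` from E-an-135₃ ∧ E-es-67♯** (the leaf's edge
`threeAdicUnitWitnessOfNoRationalThreeTorsion_of_plusIndex` took E-es-66 ∧ E-es-67; here E-es-66 := an's E-an-136₃ over `TowerUnitTwist 3`
and E-es-67 := the lead's reduction to E-es-67♯). [cite: Katz1980, Thm. 2 (m = ℓ)] -/
theorem threeAdicUnitWitnessOfNoRationalThreeTorsion_of_towerUnitTwist_of_sharp (h135 : TowerUnitTwist 3)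
    (h67s : PlusIndexPrimeToThreeOfMuThreeNoRationalThreeTorsion) : ThreeAdicUnitWitnessOfNoRationalThreeTorsion :=
  threeAdicUnitWitnessOfNoRationalThreeTorsion_of_plusIndex (threeAdicWitness_of_towerUnitTwist h135)
    (plusIndexPrimeToThreeOfNoRationalThreeTorsion_of_sharp h67s)

end Summit.BirchSwinnertonDyer.BirchSwinnertonDyer.Theorems.ManinLocalTwoThree

end
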